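import Mathlib
import Summits.ResolutionOfSingularities.ResolutionOfSingularities.Theorems.HomologicalConductorNoZenoStableAnnihilatorReduction
import HarnessLib

/-!
# Conductor elements stably annihilate first syzygies: `𝔠 ⊆ ca²(R)` for unibranch germs, FACT-FREE
# (W4.4b K-C3 §H2L: the curve-side lower bound without Wang / Esentepe 4.4)

Route `ResolutionOfSingularities/HomologicalConductor`, chain W4.4b (cell `res-hironaka`), crux `Persistence`
(stmt-ResolutionOfSingularities-16484), KILL CANDIDATE K-C3 (res-L1-w44b-plan-1 CHAIN v13.4 §V13.12: «KC3Facts — 011 to say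
whether F-DP 4/4b dispense with Esentepe»; res-type-011 answer 2026-08-27T13:12Z (B)).  [OURS; AI-written, weaker than expert
review; NOT a statement of the manuscript under study (Hironaka 2017); no named fact is used — everything here is PROVED.]

THE ARGUMENT (elementary; replaces Wang's theorem [Esentepe2020, Thm. 4.3] = the `⊇` half of [Esentepe2020, Thm. 4.4] for
UNIBRANCH germs).  Let `R → D` be an injective ring map into a principal ideal LOCAL domain `D` (a DVR or a field; for the
plane curve `C = k⟦z,t⟧/(z³ + t⁴)` take the normalisation `C ↪ k⟦s⟧`, `z ↦ −s⁴`, `t ↦ s³`), and `c ∈ R` a CONDUCTOR element: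
`c·D ⊆ R`.  Let `K` be a finitely generated `R`-module embedded in a finite free module `Rᵐ` (every first syzygy is).  Inside
`Dᵐ` let `KD` be the `D`-span of `K`: finitely generated and torsion-free over the PID `D`, hence FREE; `D` is local and `K`
generates `KD`, so a `D`-basis `k₁, …, k_r` of `KD` can be chosen INSIDE `K` (Mathlib `exists_basis_of_span_of_flat`: over a local
ring every generating family of a flat finitely presented module contains a basis).  Then `F := R k₁ ⊕ ⋯ ⊕ R k_r ⊆ K` is `R`-free and
`c·KD = ⊕ (cD) kᵢ ⊆ ⊕ R kᵢ = F`, so multiplication by `c` on `K` FACTORS THROUGH THE FREE MODULE `F`: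
`K ↪ KD →(·c) F ↪ K`.  Hence `c` stably annihilates `K`; by CA1 (`mem_cohomologyAnnihilatorOfDegree_succ_iff_forall_isSyzygy`,
[IyengarTakahashi2014, Rem. 2.3/2.13], PROVED in the tree) `c ∈ ca²(R) ⊆ ca(R)`.

* `stablyAnnihilates_of_conductor` — the factorisation, for any `K` with an injective `R`-linear map into `Fin m → R`;
* `stablyAnnihilates_of_conductor_of_isSyzygy_one` — for every first syzygy (the finitely generated projective middle term of
  `IsSyzygy 1` embeds in a finite free module);
* **`mem_cohomologyAnnihilatorOfDegree_two_of_conductor`** — `c ∈ ca²(R)` (R noetherian), and `mem_cohomologyAnnihilator_of_conductor`.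

Consumed by K-C3's K2-LOWER (`…PersistenceKC3Completion`, `…DoubleDoubleCoverCentre`): with res-L1-w44b-stub-1's K2b bricks
(`Cusp34.normHom` injective with image `⊇ s⁶·k⟦s⟧`) it yields `(z,t)²·C ⊆ ca(C)` with NO print fact, so KC3Facts shrinks to the
`⊇`-half of [Esentepe2020, Thm. 5.4] alone.  Filed `--supports stmt-ResolutionOfSingularities-16484 --as helper`.
-/

noncomputable section

-- single-problem summit: the doubled namespace component `ResolutionOfSingularities` is forced
set_option linter.dupNamespace false

namespace Summit.ResolutionOfSingularities.ResolutionOfSingularities.Theorems.HomologicalConductor.PersistenceConductorStablyAnnihilates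

open CategoryTheory Literature.RingTheory.CohomologyAnnihilator
open Summit.ResolutionOfSingularities.ResolutionOfSingularities.Theorems.NoZeno.SandwichCluster

universe u

variable {R D : Type u} [CommRing R] [CommRing D] [Algebra R D] [IsDomain D] [IsPrincipalIdealRing D] [IsLocalRing D]

/-- **Conductor elements stably annihilate embedded modules (exponent ONE).**  `R → D` injective into a principal ideal local
domain, `c ∈ R` with `c·D ⊆ R` (`hc`), `K` a finitely generated `R`-module with an injective `R`-linear map `j : K → Rᵐ`:
then `c • 𝟙 K` factors through a finitely generated free `R`-module, i.e. `StablyAnnihilates R c K`.  See the module docstring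
for the proof (`D`-span of `K` is free over the local PID `D`; a basis inside `K` by `exists_basis_of_span_of_flat`; `c·KD ⊆`
the `R`-span of that basis). [folklore] -/
theorem stablyAnnihilates_of_conductor (hinj : Function.Injective (algebraMap R D)) {c : R}
    (hc : ∀ d : D, ∃ r : R, algebraMap R D r = algebraMap R D c * d)
    (K : ModuleCat.{u} R) [Module.Finite R K] {m : ℕ} (j : K →ₗ[R] (Fin m → R)) (hj : Function.Injective j) :
    StablyAnnihilates R c K := by
  classical
  -- `K → Rᵐ → Dᵐ`
  let toD : (Fin m → R) →ₗ[R] (Fin m → D) := (Algebra.linearMap R D).compLeft (Fin m)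
  have htoD : ∀ v i, toD v i = algebraMap R D (v i) := fun v i => rfl
  have htoD_inj : Function.Injective toD := by
    intro v w h
    ext i
    exact hinj (by rw [← htoD, ← htoD, h])
  let jD : K →ₗ[R] (Fin m → D) := toD.comp j
  have hjD_inj : Function.Injective jD := htoD_inj.comp hj
  -- `KD` := the `D`-span of `K` inside `Dᵐ`
  let KD : Submodule D (Fin m → D) := Submodule.span D (Set.range jD)
  let w : K →ₗ[R] KD :=
    { toFun := fun k => ⟨jD k, Submodule.subset_span ⟨k, rfl⟩⟩
      map_add' := fun a b => by ext1; simp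
      map_smul' := fun r a => by
        ext1
        simp only [map_smul, RingHom.id_apply, Submodule.coe_smul_of_tower] }
  have hw : ∀ k, (w k : Fin m → D) = jD k := fun k => rfl
  have hw_inj : Function.Injective w := fun a b h => hjD_inj (by rw [← hw, ← hw, h])
  have hspan : Submodule.span D (Set.range w) = ⊤ := by
    have := Submodule.span_span_coe_preimage (R := D) (s := Set.range jD)
    rw [← this]
    congr 1
    ext ⟨y, hy⟩
    constructor
    · rintro ⟨k, hk⟩
      exact ⟨k, by rw [← hw, hk]⟩
    · rintro ⟨k, hk⟩
      exact ⟨k, Subtype.ext (by rw [hw, hk])⟩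
  -- `KD` is finitely generated and torsion-free over the PID `D`, hence free, hence flat and finitely presented
  haveI : IsNoetherianRing D := inferInstance
  haveI : Module.Finite D KD := Module.Finite.of_injective KD.subtype Subtype.val_injective
  haveI : Module.Free D KD := Module.free_of_finite_type_torsion_free'
  haveI : Module.FinitePresentation D KD := Module.finitePresentation_of_projective D KD
  -- a `D`-basis of `KD` inside the image of `K`
  obtain ⟨κ, a, b, hb⟩ := Module.exists_basis_of_span_of_flat (R := D) (M := KD) (fun k : K => w k) hspan
  haveI : Finite κ := Module.Finite.finite_basis b
  letI : Fintype κ := Fintype.ofFinite κ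
  -- `ι : K → (κ → R)`: the `b`-coordinates of `c • w k` lie in `R`
  have hcoord : ∀ (k : K) (i : κ), ∃ r : R, algebraMap R D r = algebraMap R D c * b.repr (w k) i :=
    fun k i => hc _
  choose ρ hρ using hcoord
  let ι : K →ₗ[R] (κ → R) :=
    { toFun := fun k i => ρ k i
      map_add' := fun k k' => by
        ext i
        apply hinj
        rw [Pi.add_apply, map_add, hρ, hρ, hρ, map_add, map_add, Finsupp.add_apply, mul_add]
      map_smul' := fun r k => by
        ext i
        apply hinj
        rw [Pi.smul_apply, RingHom.id_apply, smul_eq_mul, map_mul, hρ, hρ, map_smul,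
          ← algebraMap_smul D r (w k), map_smul, Finsupp.smul_apply, smul_eq_mul]
        ring }
  -- `π : (κ → R) → K`: `(rᵢ) ↦ Σ rᵢ • a i`
  let π : (κ → R) →ₗ[R] K := Fintype.linearCombination R (fun i => a i)
  have hπι : ∀ k : K, π (ι k) = c • k := by
    intro k
    apply hw_inj
    rw [Fintype.linearCombination_apply, map_sum, map_smul]
    -- compare inside `KD` using the basis expansion of `w k`
    have hexp : (c • w k : KD) = ∑ i, (algebraMap R D c * b.repr (w k) i) • b i := by
      conv_lhs => rw [← b.sum_repr (w k), Finset.smul_sum]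
      refine Finset.sum_congr rfl fun i _ => ?_
      rw [← algebraMap_smul D c, smul_smul]
    rw [hexp]
    refine Finset.sum_congr rfl fun i _ => ?_
    rw [map_smul, ← hb i]
    change (ρ k i) • b i = _
    rw [← algebraMap_smul D (ρ k i) (b i), hρ]
  refine ⟨ModuleCat.of R (κ → R), inferInstance, inferInstance, ModuleCat.ofHom ι, ModuleCat.ofHom π, ?_⟩
  ext k
  change π (ι k) = c • k
  exact hπι k

/-- **Conductor elements stably annihilate every FIRST SYZYGY** (`IsSyzygy 1 M K`: `K` is the kernel of a surjection from a
finitely generated projective `P`; `P` embeds in a finite free module by the lifting property, so the previous theorem applies).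
[folklore] -/
theorem stablyAnnihilates_of_conductor_of_isSyzygy_one [IsNoetherianRing R] (hinj : Function.Injective (algebraMap R D)) {c : R}
    (hc : ∀ d : D, ∃ r : R, algebraMap R D r = algebraMap R D c * d) {M K : ModuleCat.{u} R} [Module.Finite R M]
    (hK : IsSyzygy 1 M K) : StablyAnnihilates R c K := by
  haveI : Module.Finite R K := finite_of_isSyzygy 1 ‹_› hK
  obtain ⟨K', P, -, hPfin, hPproj, f, g, w, hse⟩ := hK
  haveI := hPfin
  haveI := hPproj
  haveI := hse.mono_f
  have hf : Function.Injective f.hom := (ModuleCat.mono_iff_injective f).mp inferInstance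
  -- `P` embeds in a finite free module
  obtain ⟨n, q, hq⟩ := Module.Finite.exists_fin' R P
  obtain ⟨h, hh⟩ := Module.projective_lifting_property q (LinearMap.id : P →ₗ[R] P) hq
  have hh_inj : Function.Injective h := by
    intro x y hxy
    have := congrArg q hxy
    rwa [← LinearMap.comp_apply, ← LinearMap.comp_apply, hh, LinearMap.id_apply, LinearMap.id_apply] at this
  exact stablyAnnihilates_of_conductor hinj hc K (h.comp f.hom) (hh_inj.comp hf)

/-- **`𝔠 ⊆ ca²(R)` FACT-FREE (unibranch form)**: for `R` noetherian, `R → D` injective into a principal ideal local domain and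
`c ∈ R` with `c·D ⊆ R`: `c ∈ ca²(R)` — by CA1 (`mem_cohomologyAnnihilatorOfDegree_succ_iff_forall_isSyzygy`,
[IyengarTakahashi2014, Rem. 2.3/2.13], PROVED in the tree) and `stablyAnnihilates_of_conductor_of_isSyzygy_one`.  For the E₆
curve germ `k⟦z,t⟧/(z³+t⁴) ↪ k⟦s⟧` this gives `(z,t)² ⊆ ca²` with no print fact (the `⊇` half of [Esentepe2020, Thm. 4.4] =
Wang's theorem, here bypassed). [folklore] -/
theorem mem_cohomologyAnnihilatorOfDegree_two_of_conductor [IsNoetherianRing R]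
    (hinj : Function.Injective (algebraMap R D)) {c : R} (hc : ∀ d : D, ∃ r : R, algebraMap R D r = algebraMap R D c * d) :
    c ∈ cohomologyAnnihilatorOfDegree R 2 :=
  (mem_cohomologyAnnihilatorOfDegree_succ_iff_forall_isSyzygy (n := 1) c).mpr fun _ _ hM hK => by
    haveI := hM
    exact stablyAnnihilates_of_conductor_of_isSyzygy_one hinj hc hK

/-- `𝔠 ⊆ ca(R)`, level-free form of the previous theorem. [folklore] -/
theorem mem_cohomologyAnnihilator_of_conductor [IsNoetherianRing R] (hinj : Function.Injective (algebraMap R D)) {c : R}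
    (hc : ∀ d : D, ∃ r : R, algebraMap R D r = algebraMap R D c * d) : c ∈ cohomologyAnnihilator R :=
  cohomologyAnnihilatorOfDegree_le 2 (mem_cohomologyAnnihilatorOfDegree_two_of_conductor hinj hc)

end Summit.ResolutionOfSingularities.ResolutionOfSingularities.Theorems.HomologicalConductor.PersistenceConductorStablyAnnihilates

end
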